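import Summits.QuantumFields.YangMills.Theorems.BalabanUVNodesK0Stub1Eq158FlatOpsMatrixFields
import Summits.QuantumFields.YangMills.Theorems.BalabanUVNodesK0Stub1FlatSmallSolution158AtRecord
import Literature.MathematicalPhysics.QuantumFieldTheory.Balaban1983to89.T4AdjointCovarianceUnitary
import HarnessLib

/-!
# K0⁷ STUB 1 (`stub_prop8StepCoP13`), sub-target S4a, THE ASSEMBLY JOINT OF «THE HEART, flat half»: **[15] p. 303–304 «(164), the equality (159) and Eq. (158)
# imply (165)» FOR THE TANGENT COMPONENT — a configuration `A′` critical in the sense (128) for PRINT's multi-level flat operators of a nested domain family at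
# the record, of (115)-size `≤ ρ` (print: `ρ = 36dL²B₁R₁M₁ε₀` from (152)), has its tangent component `A₁ = A′ − H_V(Q_VA′)` bounded in EVERY letter of `−G̃_V` by
# `B·C₄·ρ²`** — g0's file 1 (Prop. 6's (165) entry, `letter_solution158_recordDom_le` ∕ `letter_solution158_le_T4`) COMPOSED with this seat's file
# `…K0Stub1Eq158FlatOpsMatrixFields` ((127)∕(128) ⟹ (158) on `PBond → M_N(ℂ)`) — the two halves of S4a meet on ONE operator `G̃_V`

Cell `pub-ymgap`, width seat `pub-ymgap-k0-s1-w1` g2 (INTENT-4).  `--kind proof --supports stmt-QuantumFields-20541 --as helper`; count-neutral.  [15] = [Balaban1985Variational]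
(CMP **102** (1985) 277–309).

WHY.  Print (p. 302–304): the potential `A` of the critical `U′_k` in the gauge (152)–(153) is written as `A = A₁ + HB − HD(A₁ + HB)` ((159)) where `A₁` solves
*«A₁ + G̃((δ∕δA′)V)(A₁ + HB) = 0. (158)»*; Prop. 6's contraction then bounds `A₁` by the term *«+ B₀C₄(36dL²B₁Mε₀)²»* of (165).  In the tree the two halves were typed
separately: g0's file 1 reads Prop. 6 at the record and proves the (165) ENTRY for ANY solution of (158) whose `A₁ + 𝔄` has (115)-size `≤ ρ < a₃` — for every letter `N`
of `−G̃` (`letter_solution158_recordDom_le`: «quadratic in the class radius», the shape n07-w4's S6 token `LocalLetters165TopStep` consumes); this seat's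
`…Eq158FlatOpsMatrixFields` proves that a (128)-critical `A′` HAS its tangent component solving (158) with print's explicit `G̃_V = (G − HQG)_V`, `𝔄 = H_V(Q_VA′)`, on the
same carrier `PBond (F.P K) 0 → M_N(ℂ)`.  Since `A₁ + 𝔄 = A′`, the size hypothesis is the (115)-size of `A′` ITSELF — print p. 303: *«where A₁ satisfies Eq. (158).  We know
also that A₁ + HB satisfies the bounds (152)»* (`|A|, |∇^ηA| < 9dL²B₁Mε₀`).
THIS FILE composes: (128)-critical + (152)-small ⇒ (165) entry for `A₁`, with print's operators, for every nested family `D` at the record (multi-level weights of any domain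
sequence `Ω`, and the one-level plain edition).

WHAT IS PROVED (sorry-free; no definition; axioms standard; `V = M_N(ℂ)` with the operator norm of record, `open scoped Matrix.Norms.L2Operator`).
* §0 `extension_trace` (real kernels commute with the trace), ★ `pairing_skew_of_traceless` (S1's TEST CLASS SUFFICES: for traceless `A′`, `w`, (128) against skew TRACELESS
  test fields in `ker Q_V` — the 𝔰𝔲(N)-valued tangent directions of S1's `TangentBondSU` — already gives (128) against all skew test fields in `ker Q_V`, the hypothesis of
  `…Eq158FlatOpsMatrixFields`), `tangent_skew_traceless` (`A₁ = A′ − H_V(Q_VA′)` stays 𝔰𝔲(N)-valued).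
* ★★ `letter165_tangent_of_critical128_recordDom` — multi-level weights `wt m b` of a domain sequence (file 1 §2's shape; ANY weight family): for every nested family
  `D : Domains (F.P K)`, extensions `Δ_{a,V}, G̃_V, Q_V, H_V` (kernel formulas), `W` with Prop. 4's weighted (98)-slot `hWq` (HYPOTHESIS — S4b), skew `A′` with `W A′` skew,
  (128) against skew test fields in `ker Q_V`, `(115)`-size of `A′` `≤ ρ < a₃`, and every letter `N` with `N(−G̃_Vf) ≤ B·β` whenever `wt 3·‖f‖ ≤ β` (HYPOTHESIS — the port):
  `N(A′ − H_V(Q_VA′)) ≤ B·(C₄·ρ²)`.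
* ★ `letter165_tangent_of_critical128_T4` — the one-level plain-weight edition (file 1 §1's shape, gradient factor `L^k`).
* §2 (v1.1) `coe_lieSU_skew ∕ _trace`, `pairing_traceless_of_lieSU`, ★★ `letter165_tangent_of_critical128_recordDom_lieSU` — the 𝔰𝔲(N)-VALUED edition (S1 ∕ dag-n07-w1's
  convention `X : PBond → lieSU (Fin N)`; tests = all 𝔰𝔲(N)-valued fields in `ker Q_V`; skewness ∕ tracelessness automatic).
HONEST SCOPE.  A COMPOSITION of two tree theorems; the hypotheses `hWq` (Prop. 4 ∕ (98), k0-s1-w2), `hN` (the letters of `G̃_V` = [B6] Cor. 2.8 at d = 4, k0-s1-w3's port),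
the (115)-size of `A′` ((152), S3's token) and (128) (S2's chart at a critical configuration) are DISPLAYED, not discharged; FLAT background; which `D` realises Sect. F's
collared cube at the record is S3's (LOCATED-S5-1 on the support geometry stands); nothing of Bałaban's analysis asserted; `stub_prop8StepCoP13` ∕ K0⁷ NOT closed; N07 NOT
discharged; counts unmoved (28∕28 · 5∕27); one finite 𝕋⁴ programme at fixed ε — R4 closes the conditional finite-𝕋⁴ rung `BalabanLadder.UV` only, never the summit;
the YM mass gap (Clay) is NOT proved by any of this; nothing continuum ∕ ℝ⁴ ∕ OS.  No `sorry`, no `def`, no `instance`, no `notation`.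

References: [15] (115) p.294, Prop. 6 p.295, (127)–(133) pp.297–298, (143) p.300, (152) p.301, (156)–(159) pp.302–303, (165) p.304.
-/

set_option autoImplicit false
noncomputable section
open scoped BigOperators Matrix Matrix.Norms.L2Operator

namespace Summit.QuantumFields.YangMills.Theorems.K0Stub1Letter165OfCriticalFlatOps

open Literature.MathematicalPhysics.QuantumFieldTheory.Balaban1983to89
open Literature.MathematicalPhysics.QuantumFieldTheory.Balaban1983to89.T4Continuum (T4Family)
open B6SectADomainsV1 (Domains)
open B6SectAOperatorsV1 (BondIdx BondIdxSpace QE QsE)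
open B6SectAVectorModelV1 (deltaAE GE EE)
open B6SectA (hOp)
open Summit.QuantumFields.YangMills.Theorems.FlatScalarExtension (apply_eq_sum_kernel)
open Summit.QuantumFields.YangMills.Theorems.K0Stub1Eq158FlatOpsMatrixFields (eq158_flatOps_matrixFields extension_real_smul)
open Summit.QuantumFields.YangMills.Theorems.K0Stub1FlatSmallSolution158AtRecord (letter_solution158_recordDom_le letter_solution158_le_T4)

/-! ## §0  S1's test class: for TRACELESS (𝔰𝔲(N)-valued) fields, (128) against traceless skew test fields already gives (128) against all skew test fields -/

section TestClass

variable {ι κ : Type*} [Fintype ι] [DecidableEq ι] {n : Type*} [Fintype n]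

/-- The trace of a componentwise extension: `tr((G_V A)(b)) = Σ_j (g e_j)(b)·tr(A(j))` — real kernels commute with the trace; in particular traceless fields stay traceless.
[cite: Balaban1985Variational, p.288 («suppressed matrix indices»)] -/
theorem extension_trace (g : (ι → ℝ) →ₗ[ℝ] (κ → ℝ)) {Gv : (ι → Matrix n n ℂ) →ₗ[ℂ] (κ → Matrix n n ℂ)}
    (hGv : ∀ (A : ι → Matrix n n ℂ) (b : κ), Gv A b = ∑ j, ((g (Pi.single j 1) b : ℝ) : ℂ) • A j) (A : ι → Matrix n n ℂ) (b : κ) :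
    (Gv A b).trace = ∑ j, ((g (Pi.single j 1) b : ℝ) : ℂ) * (A j).trace := by
  rw [hGv, Matrix.trace_sum]
  exact Finset.sum_congr rfl fun j _ => by rw [Matrix.trace_smul, smul_eq_mul]

variable [DecidableEq n]

/-- **S1's TEST CLASS SUFFICES FOR 𝔰𝔲(N)-VALUED FIELDS**: if `A′` and `w` are traceless and the (128)-pairing `Σ_j Re tr(δ_j*((Δ_VA′)_j + w_j))` vanishes for every skew-Hermitian
TRACELESS test field `δ` with `Q_Vδ = 0` (the tangent directions of S1's carrier `TangentBondSU`, 𝔰𝔲(N)-valued), then it vanishes for every skew-Hermitian test field with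
`Q_Vδ = 0` (the hypothesis of `…Eq158FlatOpsMatrixFields`): the central part `(tr δ_j∕N)·1` of a skew test field pairs to `Re(conj(c_j)·tr E_j) = 0` against the traceless
`E = Δ_VA′ + w`, and its traceless part is again `Q_V`-null (take traces of `Q_Vδ = 0`). [cite: Balaban1985Variational, (127)–(128) p.297, p.288] -/
theorem pairing_skew_of_traceless (dlt : (ι → ℝ) →ₗ[ℝ] (ι → ℝ)) (q : (ι → ℝ) →ₗ[ℝ] (κ → ℝ))
    {DV : (ι → Matrix n n ℂ) →ₗ[ℂ] (ι → Matrix n n ℂ)} {QV : (ι → Matrix n n ℂ) →ₗ[ℂ] (κ → Matrix n n ℂ)}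
    (hDV : ∀ (A : ι → Matrix n n ℂ) (b : ι), DV A b = ∑ j, ((dlt (Pi.single j 1) b : ℝ) : ℂ) • A j)
    (hQV : ∀ (A : ι → Matrix n n ℂ) (t : κ), QV A t = ∑ j, ((q (Pi.single j 1) t : ℝ) : ℂ) • A j)
    {A' w : ι → Matrix n n ℂ} (hA'tr : ∀ j, (A' j).trace = 0) (hwtr : ∀ j, (w j).trace = 0)
    (h : ∀ δ : ι → Matrix n n ℂ, (∀ j, (δ j)ᴴ = -δ j) → (∀ j, (δ j).trace = 0) → QV δ = 0 →
      ∑ j, ((δ j)ᴴ * (DV A' j + w j)).trace.re = 0) :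
    ∀ δ : ι → Matrix n n ℂ, (∀ j, (δ j)ᴴ = -δ j) → QV δ = 0 → ∑ j, ((δ j)ᴴ * (DV A' j + w j)).trace.re = 0 := by
  intro δ hδ hQ
  have hEtr : ∀ j, (DV A' j + w j).trace = 0 := fun j => by
    rw [Matrix.trace_add, extension_trace dlt hDV, hwtr j, add_zero]
    exact Finset.sum_eq_zero fun k _ => by rw [hA'tr k, mul_zero]
  by_cases hn : Fintype.card n = 0
  · haveI : IsEmpty n := Fintype.card_eq_zero_iff.mp hn
    exact Finset.sum_eq_zero fun j _ => by
      rw [Subsingleton.elim ((δ j)ᴴ * (DV A' j + w j)) 0, Matrix.trace_zero, Complex.zero_re]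
  have hcard : (Fintype.card n : ℂ) ≠ 0 := Nat.cast_ne_zero.mpr hn
  -- the central parts `c_j = tr(δ_j)∕card` are purely imaginary: `c_j = y_j·i`
  set y : ι → ℝ := fun j => ((δ j).trace / (Fintype.card n : ℂ)).im with hy
  have hc : ∀ j, (δ j).trace / (Fintype.card n : ℂ) = ((y j : ℝ) : ℂ) * Complex.I := by
    intro j
    have hre : ((δ j).trace).re = 0 := by
      have h1 := congrArg Matrix.trace (hδ j)
      rw [Matrix.trace_conjTranspose, Matrix.trace_neg, Complex.star_def] at h1
      have h2 := congrArg Complex.re h1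
      rw [Complex.conj_re, Complex.neg_re] at h2
      linarith
    apply Complex.ext
    · simp [Complex.div_natCast_re, hre]
    · simp [hy]
  -- the traceless part `δ₀ = δ − c·1`
  set δ₀ : ι → Matrix n n ℂ := fun j => δ j - ((δ j).trace / (Fintype.card n : ℂ)) • (1 : Matrix n n ℂ) with hδ₀
  have hsplit : ∀ j, δ j = δ₀ j + (((y j : ℝ) : ℂ) * Complex.I) • (1 : Matrix n n ℂ) := fun j => by
    rw [hδ₀, ← hc j]; simp
  have hδ₀skew : ∀ j, (δ₀ j)ᴴ = -δ₀ j := fun j => by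
    have hstar : star (((y j : ℝ) : ℂ) * Complex.I) = -(((y j : ℝ) : ℂ) * Complex.I) := by
      rw [star_mul', Complex.star_def, Complex.conj_ofReal, Complex.conj_I, mul_neg]
    show (δ j - ((δ j).trace / (Fintype.card n : ℂ)) • (1 : Matrix n n ℂ))ᴴ = -(δ j - ((δ j).trace / (Fintype.card n : ℂ)) • (1 : Matrix n n ℂ))
    rw [hc j, Matrix.conjTranspose_sub, Matrix.conjTranspose_smul, Matrix.conjTranspose_one, hδ j, hstar, neg_smul, sub_neg_eq_add,
      neg_sub', sub_neg_eq_add]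
  have hδ₀tr : ∀ j, (δ₀ j).trace = 0 := fun j => by
    simp only [hδ₀, Matrix.trace_sub, Matrix.trace_smul, Matrix.trace_one, smul_eq_mul]
    rw [div_mul_cancel₀ _ hcard, sub_self]
  -- `q y = 0`: take traces of `Q_V δ = 0`
  have hqy : q y = 0 := by
    funext t
    have h1 := congrArg Matrix.trace (congrFun hQ t)
    rw [extension_trace q hQV, Pi.zero_apply, Matrix.trace_zero] at h1
    have h2 : ∑ j, ((q (Pi.single j 1) t : ℝ) : ℂ) * (δ j).trace =
        (Fintype.card n : ℂ) * Complex.I * ∑ j, ((y j : ℝ) : ℂ) * ((q (Pi.single j 1) t : ℝ) : ℂ) := by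
      rw [Finset.mul_sum]
      refine Finset.sum_congr rfl fun j _ => ?_
      have : (δ j).trace = (Fintype.card n : ℂ) * (((y j : ℝ) : ℂ) * Complex.I) := by
        rw [← hc j, mul_div_cancel₀ _ hcard]
      rw [this]; ring
    rw [h2] at h1
    have h3 : ∑ j, ((y j : ℝ) : ℂ) * ((q (Pi.single j 1) t : ℝ) : ℂ) = 0 := by
      rcases mul_eq_zero.mp h1 with h4 | h4
      · exact absurd h4 (mul_ne_zero hcard Complex.I_ne_zero)
      · exact h4
    have h5 : ((q y t : ℝ) : ℂ) = 0 := by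
      rw [apply_eq_sum_kernel q y t, Complex.ofReal_sum]
      simpa only [Complex.ofReal_mul] using h3
    exact_mod_cast h5
  have hQδ₀ : QV δ₀ = 0 := by
    have hcentral : QV (fun j => (((y j : ℝ) : ℂ) * Complex.I) • (1 : Matrix n n ℂ)) = 0 := by
      funext t
      have := extension_real_smul q hQV y (Complex.I • (1 : Matrix n n ℂ)) t
      simp only [smul_smul] at this
      rw [Pi.zero_apply, this, hqy, Pi.zero_apply, Complex.ofReal_zero, zero_mul, zero_smul]
    have hδeq : δ = δ₀ + fun j => (((y j : ℝ) : ℂ) * Complex.I) • (1 : Matrix n n ℂ) := funext fun j => by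
      rw [Pi.add_apply]; exact hsplit j
    have := hQ
    rw [hδeq, map_add, hcentral, add_zero] at this
    exact this
  -- the pairing splits; the central part pairs to zero against the traceless `E`
  have hmain := h δ₀ hδ₀skew hδ₀tr hQδ₀
  rw [← hmain]
  refine Finset.sum_congr rfl fun j _ => ?_
  rw [hsplit j, Matrix.conjTranspose_add, Matrix.add_mul, Matrix.trace_add, Complex.add_re, Matrix.conjTranspose_smul,
    Matrix.conjTranspose_one, Matrix.smul_mul, Matrix.one_mul, Matrix.trace_smul, smul_eq_mul, hEtr j, mul_zero, Complex.zero_re, add_zero]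

variable [Fintype κ] [DecidableEq κ]

omit [DecidableEq n] in
/-- **THE TANGENT COMPONENT STAYS LIE-ALGEBRA-VALUED**: for componentwise extensions `Q_V`, `H_V` (real kernels) and a skew-Hermitian traceless `A′` (𝔰𝔲(N)-valued), the
tangent component `A₁ = A′ − H_V(Q_VA′)` of (159) is skew-Hermitian and traceless (print: `A₁` is a 𝔤-valued configuration, p. 302). [cite: Balaban1985Variational, (158)–(159) pp.302–303, p.288] -/
theorem tangent_skew_traceless (q : (ι → ℝ) →ₗ[ℝ] (κ → ℝ)) (h : (κ → ℝ) →ₗ[ℝ] (ι → ℝ))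
    {QV : (ι → Matrix n n ℂ) →ₗ[ℂ] (κ → Matrix n n ℂ)} {HV : (κ → Matrix n n ℂ) →ₗ[ℂ] (ι → Matrix n n ℂ)}
    (hQV : ∀ (A : ι → Matrix n n ℂ) (t : κ), QV A t = ∑ j, ((q (Pi.single j 1) t : ℝ) : ℂ) • A j)
    (hHV : ∀ (B : κ → Matrix n n ℂ) (b : ι), HV B b = ∑ t, ((h (Pi.single t 1) b : ℝ) : ℂ) • B t)
    {A' : ι → Matrix n n ℂ} (hA : ∀ j, (A' j)ᴴ = -A' j) (hAtr : ∀ j, (A' j).trace = 0) (j : ι) :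
    ((A' - HV (QV A')) j)ᴴ = -((A' - HV (QV A')) j) ∧ ((A' - HV (QV A')) j).trace = 0 := by
  have hQskew : ∀ t, (QV A' t)ᴴ = -(QV A' t) := K0Stub1Eq158FlatOpsMatrixFields.extension_skew q hQV hA
  have hQtr : ∀ t, (QV A' t).trace = 0 := fun t => by
    rw [extension_trace q hQV]; exact Finset.sum_eq_zero fun k _ => by rw [hAtr k, mul_zero]
  refine ⟨?_, ?_⟩
  · rw [Pi.sub_apply, Matrix.conjTranspose_sub, hA j, K0Stub1Eq158FlatOpsMatrixFields.extension_skew h hHV hQskew j, neg_sub_neg, neg_sub]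
  · rw [Pi.sub_apply, Matrix.trace_sub, hAtr j, extension_trace h hHV, zero_sub, neg_eq_zero]
    exact Finset.sum_eq_zero fun t _ => by rw [hQtr t, mul_zero]

end TestClass

variable {N : ℕ}

open scoped Classical in
/-- ★★ **(128)-CRITICAL + (152)-SMALL ⇒ THE (165) ENTRY FOR THE TANGENT COMPONENT, WITH PRINT's MULTI-LEVEL FLAT OPERATORS, AT THE RECORD** (fine torus `Site (F.P K) 0`,
`M_N(ℂ)`-valued bond fields, multi-level weights `wt m b` of a domain sequence — file 1 §2's shape, ANY weight family): for a nested family `D`, componentwise extensions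
`Δ_{a,V}, G̃_V, Q_V, H_V` of lit-balaban's `deltaAE D c w`, print's `G̃ = G − HQG`, `QE D`, print's `H`, a map `W` (print's `(δ∕δA′)V`) with Prop. 4's weighted (98)-slot, a
skew-Hermitian `A′` with `W A′` skew, critical in the sense (128) against skew test fields in `ker Q_V`, of weighted (115)-size `≤ ρ < a₃`: for every letter `N` of `−G̃_V` with
constant `B` on the `wt 3`-weighted sup-ball, `N(A′ − H_V(Q_VA′)) ≤ B·(C₄·ρ²)` — *«+ B₀C₄(36dL²B₁Mε₀)²»* of (165) for the tangent component `A₁` of (159).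
(`eq158_flatOps_matrixFields` ∘ `letter_solution158_recordDom_le`, using `A₁ + H_V(Q_VA′) = A′`.) [cite: Balaban1985Variational, (158)–(159) pp.302–303, (165) p.304, (152) p.301, (115) p.294] -/
theorem letter165_tangent_of_critical128_recordDom (F : T4Family) (K k : ℕ) (wt : ℕ → PBond (F.P K) 0 → ℝ)
    (D : Domains (F.P K)) {c : ℝ} (hc : c ≠ 0) {w : BondIdx D → ℝ} (hw : ∀ i, 0 < w i)
    {DV GV : (PBond (F.P K) 0 → Matrix (Fin N) (Fin N) ℂ) →ₗ[ℂ] (PBond (F.P K) 0 → Matrix (Fin N) (Fin N) ℂ)}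
    {QV : (PBond (F.P K) 0 → Matrix (Fin N) (Fin N) ℂ) →ₗ[ℂ] (BondIdx D → Matrix (Fin N) (Fin N) ℂ)}
    {HV : (BondIdx D → Matrix (Fin N) (Fin N) ℂ) →ₗ[ℂ] (PBond (F.P K) 0 → Matrix (Fin N) (Fin N) ℂ)}
    (hDV : ∀ (A : PBond (F.P K) 0 → Matrix (Fin N) (Fin N) ℂ) (b : PBond (F.P K) 0),
      DV A b = ∑ j, ((WithLp.ofLp (deltaAE D c w (WithLp.toLp 2 (Pi.single j 1))) b : ℝ) : ℂ) • A j)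
    (hGV : ∀ (A : PBond (F.P K) 0 → Matrix (Fin N) (Fin N) ℂ) (b : PBond (F.P K) 0),
      GV A b = ∑ j, ((WithLp.ofLp ((GE D hc hw - hOp (GE D hc hw) (QsE D) (EE D hc hw) ∘ₗ QE D ∘ₗ GE D hc hw)
        (WithLp.toLp 2 (Pi.single j 1))) b : ℝ) : ℂ) • A j)
    (hQV : ∀ (A : PBond (F.P K) 0 → Matrix (Fin N) (Fin N) ℂ) (t : BondIdx D),
      QV A t = ∑ j, ((WithLp.ofLp (QE D (WithLp.toLp 2 (Pi.single j 1))) t : ℝ) : ℂ) • A j)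
    (hHV : ∀ (B : BondIdx D → Matrix (Fin N) (Fin N) ℂ) (b : PBond (F.P K) 0),
      HV B b = ∑ t, ((WithLp.ofLp (hOp (GE D hc hw) (QsE D) (EE D hc hw) (WithLp.toLp 2 (Pi.single t 1))) b : ℝ) : ℂ) • B t)
    (W : (PBond (F.P K) 0 → Matrix (Fin N) (Fin N) ℂ) → (PBond (F.P K) 0 → Matrix (Fin N) (Fin N) ℂ)) {C₄ a₃ ρ : ℝ}
    (hWq : ∀ (Y : PBond (F.P K) 0 → Matrix (Fin N) (Fin N) ℂ) (r : ℝ), r < a₃ → (∀ b, wt 1 b * ‖Y b‖ ≤ r) →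
      (∀ (b : PBond (F.P K) 0) (ν : Fin 4), wt 2 b * (F.L : ℝ) ^ k * ‖Y ⟨b.src.shift ν, b.dir⟩ - Y b‖ ≤ r) →
        ∀ b, wt 3 b * ‖W Y b‖ ≤ C₄ * r ^ 2)
    {A' : PBond (F.P K) 0 → Matrix (Fin N) (Fin N) ℂ} (hA : ∀ j, (A' j)ᴴ = -A' j) (hWA : ∀ j, (W A' j)ᴴ = -(W A' j))
    (h128 : ∀ δ : PBond (F.P K) 0 → Matrix (Fin N) (Fin N) ℂ, (∀ j, (δ j)ᴴ = -δ j) → QV δ = 0 →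
      ∑ j, ((δ j)ᴴ * (DV A' j + W A' j)).trace.re = 0)
    (hρ : ρ < a₃) (h1 : ∀ b, wt 1 b * ‖A' b‖ ≤ ρ)
    (h2 : ∀ (b : PBond (F.P K) 0) (ν : Fin 4), wt 2 b * (F.L : ℝ) ^ k * ‖A' ⟨b.src.shift ν, b.dir⟩ - A' b‖ ≤ ρ)
    (Nl : (PBond (F.P K) 0 → Matrix (Fin N) (Fin N) ℂ) → ℝ) {B : ℝ}
    (hN : ∀ (f : PBond (F.P K) 0 → Matrix (Fin N) (Fin N) ℂ) (β : ℝ), (∀ b, wt 3 b * ‖f b‖ ≤ β) → Nl (-(GV f)) ≤ B * β) :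
    Nl (A' - HV (QV A')) ≤ B * (C₄ * ρ ^ 2) := by
  have hsol := eq158_flatOps_matrixFields D hc hw hDV hGV hQV hHV W hA hWA h128
  refine letter_solution158_recordDom_le F K k wt GV W hWq hsol hρ (fun b => ?_) (fun b ν => ?_) Nl hN
  · rw [sub_add_cancel]; exact h1 b
  · rw [sub_add_cancel]; exact h2 b ν

open scoped Classical in
/-- ★ **THE SAME, ONE LEVEL, PLAIN (115)-WEIGHTS** (file 1 §1's shape: sup and `L^k`-weighted forward differences): (128)-critical + `|A′|, L^k·|∇A′| ≤ ρ < a₃` ⇒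
`N(A′ − H_V(Q_VA′)) ≤ B·(C₄·ρ²)` for every letter `N` of `−G̃_V`. [cite: Balaban1985Variational, (158) p.302, (165) p.304, (115) p.294] -/
theorem letter165_tangent_of_critical128_T4 (F : T4Family) (K k : ℕ)
    (D : Domains (F.P K)) {c : ℝ} (hc : c ≠ 0) {w : BondIdx D → ℝ} (hw : ∀ i, 0 < w i)
    {DV GV : (PBond (F.P K) 0 → Matrix (Fin N) (Fin N) ℂ) →ₗ[ℂ] (PBond (F.P K) 0 → Matrix (Fin N) (Fin N) ℂ)}
    {QV : (PBond (F.P K) 0 → Matrix (Fin N) (Fin N) ℂ) →ₗ[ℂ] (BondIdx D → Matrix (Fin N) (Fin N) ℂ)}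
    {HV : (BondIdx D → Matrix (Fin N) (Fin N) ℂ) →ₗ[ℂ] (PBond (F.P K) 0 → Matrix (Fin N) (Fin N) ℂ)}
    (hDV : ∀ (A : PBond (F.P K) 0 → Matrix (Fin N) (Fin N) ℂ) (b : PBond (F.P K) 0),
      DV A b = ∑ j, ((WithLp.ofLp (deltaAE D c w (WithLp.toLp 2 (Pi.single j 1))) b : ℝ) : ℂ) • A j)
    (hGV : ∀ (A : PBond (F.P K) 0 → Matrix (Fin N) (Fin N) ℂ) (b : PBond (F.P K) 0),
      GV A b = ∑ j, ((WithLp.ofLp ((GE D hc hw - hOp (GE D hc hw) (QsE D) (EE D hc hw) ∘ₗ QE D ∘ₗ GE D hc hw)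
        (WithLp.toLp 2 (Pi.single j 1))) b : ℝ) : ℂ) • A j)
    (hQV : ∀ (A : PBond (F.P K) 0 → Matrix (Fin N) (Fin N) ℂ) (t : BondIdx D),
      QV A t = ∑ j, ((WithLp.ofLp (QE D (WithLp.toLp 2 (Pi.single j 1))) t : ℝ) : ℂ) • A j)
    (hHV : ∀ (B : BondIdx D → Matrix (Fin N) (Fin N) ℂ) (b : PBond (F.P K) 0),
      HV B b = ∑ t, ((WithLp.ofLp (hOp (GE D hc hw) (QsE D) (EE D hc hw) (WithLp.toLp 2 (Pi.single t 1))) b : ℝ) : ℂ) • B t)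
    (W : (PBond (F.P K) 0 → Matrix (Fin N) (Fin N) ℂ) → (PBond (F.P K) 0 → Matrix (Fin N) (Fin N) ℂ)) {C₄ a₃ ρ : ℝ}
    (hWq : ∀ (Y : PBond (F.P K) 0 → Matrix (Fin N) (Fin N) ℂ) (r : ℝ), r < a₃ → (∀ b, ‖Y b‖ ≤ r) →
      (∀ (s : Site (F.P K) 0) (μ ν : Fin 4), (F.L : ℝ) ^ k * ‖Y ⟨s.shift ν, μ⟩ - Y ⟨s, μ⟩‖ ≤ r) → ∀ b, ‖W Y b‖ ≤ C₄ * r ^ 2)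
    {A' : PBond (F.P K) 0 → Matrix (Fin N) (Fin N) ℂ} (hA : ∀ j, (A' j)ᴴ = -A' j) (hWA : ∀ j, (W A' j)ᴴ = -(W A' j))
    (h128 : ∀ δ : PBond (F.P K) 0 → Matrix (Fin N) (Fin N) ℂ, (∀ j, (δ j)ᴴ = -δ j) → QV δ = 0 →
      ∑ j, ((δ j)ᴴ * (DV A' j + W A' j)).trace.re = 0)
    (hρ : ρ < a₃) (h1 : ∀ b, ‖A' b‖ ≤ ρ)
    (h2 : ∀ (s : Site (F.P K) 0) (μ ν : Fin 4), (F.L : ℝ) ^ k * ‖A' ⟨s.shift ν, μ⟩ - A' ⟨s, μ⟩‖ ≤ ρ)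
    (Nl : (PBond (F.P K) 0 → Matrix (Fin N) (Fin N) ℂ) → ℝ) {B : ℝ}
    (hN : ∀ (f : PBond (F.P K) 0 → Matrix (Fin N) (Fin N) ℂ) (β : ℝ), (∀ b, ‖f b‖ ≤ β) → Nl (-(GV f)) ≤ B * β) :
    Nl (A' - HV (QV A')) ≤ B * (C₄ * ρ ^ 2) := by
  have hsol := eq158_flatOps_matrixFields D hc hw hDV hGV hQV hHV W hA hWA h128
  refine letter_solution158_le_T4 F K k GV W hWq hsol hρ (fun b => ?_) (fun s μ ν => ?_) Nl hN
  · rw [sub_add_cancel]; exact h1 b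
  · rw [sub_add_cancel]; exact h2 s μ ν

/-! ## §2  (v1.1) 𝔰𝔲(N)-VALUED editions — S1 ∕ dag-n07-w1's convention `X : PBond → lieSU (Fin N)`: skewness and tracelessness are automatic, the tests range over
ALL 𝔰𝔲(N)-valued fields in `ker Q_V`, and §0's reduction supplies the hypothesis of §1 -/

section LieSU

open Literature.MathematicalPhysics.QuantumFieldTheory.Balaban1983to89.T4AdjointCovarianceUnitary (lieSU mem_lieSU_iff)

/-- An `𝔰𝔲(N)` element, coerced to `M_N(ℂ)`, is skew-Hermitian. [folklore] -/
theorem coe_lieSU_skew (X : lieSU (Fin N)) : ((X : Matrix (Fin N) (Fin N) ℂ))ᴴ = -(X : Matrix (Fin N) (Fin N) ℂ) := by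
  rw [← Matrix.star_eq_conjTranspose]; exact (mem_lieSU_iff.mp X.2).1

/-- An `𝔰𝔲(N)` element, coerced to `M_N(ℂ)`, is traceless. [folklore] -/
theorem coe_lieSU_trace (X : lieSU (Fin N)) : ((X : Matrix (Fin N) (Fin N) ℂ)).trace = 0 := (mem_lieSU_iff.mp X.2).2

/-- **TEST-CLASS CONVERSION**: a pairing hypothesis against all `𝔰𝔲(N)`-VALUED test fields `δ : ι → lieSU (Fin N)` with `Q_V δ = 0` (S1 ∕ dag-n07-w1's tangent directions) is
the hypothesis of §0's `pairing_skew_of_traceless` (skew-Hermitian traceless matrix test fields). [cite: Balaban1985Variational, (127)–(128) p.297, p.288] -/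
theorem pairing_traceless_of_lieSU {ι κ : Type*} [Fintype ι] {QV : (ι → Matrix (Fin N) (Fin N) ℂ) →ₗ[ℂ] (κ → Matrix (Fin N) (Fin N) ℂ)}
    {E : ι → Matrix (Fin N) (Fin N) ℂ}
    (h : ∀ δ : ι → lieSU (Fin N), QV (fun j => ((δ j : lieSU (Fin N)) : Matrix (Fin N) (Fin N) ℂ)) = 0 →
      ∑ j, (((δ j : lieSU (Fin N)) : Matrix (Fin N) (Fin N) ℂ)ᴴ * E j).trace.re = 0) :
    ∀ δ : ι → Matrix (Fin N) (Fin N) ℂ, (∀ j, (δ j)ᴴ = -δ j) → (∀ j, (δ j).trace = 0) → QV δ = 0 → ∑ j, ((δ j)ᴴ * E j).trace.re = 0 := by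
  intro δ hδ htr hQ
  exact h (fun j => ⟨δ j, mem_lieSU_iff.mpr ⟨by rw [Matrix.star_eq_conjTranspose]; exact hδ j, htr j⟩⟩) hQ

open scoped Classical in
/-- ★★ **THE (165) ENTRY FOR THE TANGENT COMPONENT OF AN 𝔰𝔲(N)-VALUED (128)-CRITICAL FIELD** — §1's `letter165_tangent_of_critical128_recordDom` for `A′ = X` with
`X : PBond (F.P K) 0 → 𝔰𝔲(N)` (S1's tangent directions; skew ∕ traceless automatic), `W X` 𝔰𝔲(N)-valued (skew, traceless), and the (128)-pairing hypothesis against ALL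
𝔰𝔲(N)-valued test fields in `ker Q_V` (§0 `pairing_skew_of_traceless` bridges to §1's skew test class): `N(X − H_V(Q_VX)) ≤ B·(C₄·ρ²)` for every letter `N` of `−G̃_V`.
[cite: Balaban1985Variational, (158)–(159) pp.302–303, (165) p.304, (152) p.301] -/
theorem letter165_tangent_of_critical128_recordDom_lieSU (F : T4Family) (K k : ℕ) (wt : ℕ → PBond (F.P K) 0 → ℝ)
    (D : Domains (F.P K)) {c : ℝ} (hc : c ≠ 0) {w : BondIdx D → ℝ} (hw : ∀ i, 0 < w i)
    {DV GV : (PBond (F.P K) 0 → Matrix (Fin N) (Fin N) ℂ) →ₗ[ℂ] (PBond (F.P K) 0 → Matrix (Fin N) (Fin N) ℂ)}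
    {QV : (PBond (F.P K) 0 → Matrix (Fin N) (Fin N) ℂ) →ₗ[ℂ] (BondIdx D → Matrix (Fin N) (Fin N) ℂ)}
    {HV : (BondIdx D → Matrix (Fin N) (Fin N) ℂ) →ₗ[ℂ] (PBond (F.P K) 0 → Matrix (Fin N) (Fin N) ℂ)}
    (hDV : ∀ (A : PBond (F.P K) 0 → Matrix (Fin N) (Fin N) ℂ) (b : PBond (F.P K) 0),
      DV A b = ∑ j, ((WithLp.ofLp (deltaAE D c w (WithLp.toLp 2 (Pi.single j 1))) b : ℝ) : ℂ) • A j)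
    (hGV : ∀ (A : PBond (F.P K) 0 → Matrix (Fin N) (Fin N) ℂ) (b : PBond (F.P K) 0),
      GV A b = ∑ j, ((WithLp.ofLp ((GE D hc hw - hOp (GE D hc hw) (QsE D) (EE D hc hw) ∘ₗ QE D ∘ₗ GE D hc hw)
        (WithLp.toLp 2 (Pi.single j 1))) b : ℝ) : ℂ) • A j)
    (hQV : ∀ (A : PBond (F.P K) 0 → Matrix (Fin N) (Fin N) ℂ) (t : BondIdx D),
      QV A t = ∑ j, ((WithLp.ofLp (QE D (WithLp.toLp 2 (Pi.single j 1))) t : ℝ) : ℂ) • A j)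
    (hHV : ∀ (B : BondIdx D → Matrix (Fin N) (Fin N) ℂ) (b : PBond (F.P K) 0),
      HV B b = ∑ t, ((WithLp.ofLp (hOp (GE D hc hw) (QsE D) (EE D hc hw) (WithLp.toLp 2 (Pi.single t 1))) b : ℝ) : ℂ) • B t)
    (W : (PBond (F.P K) 0 → Matrix (Fin N) (Fin N) ℂ) → (PBond (F.P K) 0 → Matrix (Fin N) (Fin N) ℂ)) {C₄ a₃ ρ : ℝ}
    (hWq : ∀ (Y : PBond (F.P K) 0 → Matrix (Fin N) (Fin N) ℂ) (r : ℝ), r < a₃ → (∀ b, wt 1 b * ‖Y b‖ ≤ r) →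
      (∀ (b : PBond (F.P K) 0) (ν : Fin 4), wt 2 b * (F.L : ℝ) ^ k * ‖Y ⟨b.src.shift ν, b.dir⟩ - Y b‖ ≤ r) →
        ∀ b, wt 3 b * ‖W Y b‖ ≤ C₄ * r ^ 2)
    (X : PBond (F.P K) 0 → lieSU (Fin N))
    (hWA : ∀ j, (W (fun b => ((X b : lieSU (Fin N)) : Matrix (Fin N) (Fin N) ℂ)) j)ᴴ = -(W (fun b => ((X b : lieSU (Fin N)) : Matrix (Fin N) (Fin N) ℂ)) j))
    (hWtr : ∀ j, (W (fun b => ((X b : lieSU (Fin N)) : Matrix (Fin N) (Fin N) ℂ)) j).trace = 0)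
    (h128 : ∀ δ : PBond (F.P K) 0 → lieSU (Fin N), QV (fun j => ((δ j : lieSU (Fin N)) : Matrix (Fin N) (Fin N) ℂ)) = 0 →
      ∑ j, (((δ j : lieSU (Fin N)) : Matrix (Fin N) (Fin N) ℂ)ᴴ *
        (DV (fun b => ((X b : lieSU (Fin N)) : Matrix (Fin N) (Fin N) ℂ)) j + W (fun b => ((X b : lieSU (Fin N)) : Matrix (Fin N) (Fin N) ℂ)) j)).trace.re = 0)
    (hρ : ρ < a₃) (h1 : ∀ b, wt 1 b * ‖((X b : lieSU (Fin N)) : Matrix (Fin N) (Fin N) ℂ)‖ ≤ ρ)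
    (h2 : ∀ (b : PBond (F.P K) 0) (ν : Fin 4),
      wt 2 b * (F.L : ℝ) ^ k * ‖((X ⟨b.src.shift ν, b.dir⟩ : lieSU (Fin N)) : Matrix (Fin N) (Fin N) ℂ) - ((X b : lieSU (Fin N)) : Matrix (Fin N) (Fin N) ℂ)‖ ≤ ρ)
    (Nl : (PBond (F.P K) 0 → Matrix (Fin N) (Fin N) ℂ) → ℝ) {B : ℝ}
    (hN : ∀ (f : PBond (F.P K) 0 → Matrix (Fin N) (Fin N) ℂ) (β : ℝ), (∀ b, wt 3 b * ‖f b‖ ≤ β) → Nl (-(GV f)) ≤ B * β) :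
    Nl ((fun b => ((X b : lieSU (Fin N)) : Matrix (Fin N) (Fin N) ℂ)) - HV (QV fun b => ((X b : lieSU (Fin N)) : Matrix (Fin N) (Fin N) ℂ))) ≤ B * (C₄ * ρ ^ 2) := by
  refine letter165_tangent_of_critical128_recordDom F K k wt D hc hw hDV hGV hQV hHV W hWq (fun j => coe_lieSU_skew (X j)) hWA ?_ hρ h1 h2 Nl hN
  -- §0: the 𝔰𝔲(N) test class suffices (plain-function editions of `Δ_a`, `Q` for the kernel formulas)
  refine pairing_skew_of_traceless
    ((WithLp.linearEquiv 2 ℝ (PBond (F.P K) 0 → ℝ)).toLinearMap ∘ₗ deltaAE D c w ∘ₗ (WithLp.linearEquiv 2 ℝ (PBond (F.P K) 0 → ℝ)).symm.toLinearMap)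
    ((WithLp.linearEquiv 2 ℝ (BondIdx D → ℝ)).toLinearMap ∘ₗ QE D ∘ₗ (WithLp.linearEquiv 2 ℝ (PBond (F.P K) 0 → ℝ)).symm.toLinearMap)
    (fun A b => ?_) (fun A t => ?_) (fun j => coe_lieSU_trace (X j)) hWtr (pairing_traceless_of_lieSU h128)
  · simp only [LinearMap.comp_apply, LinearEquiv.coe_coe, WithLp.coe_linearEquiv, WithLp.coe_symm_linearEquiv]; exact hDV A b
  · simp only [LinearMap.comp_apply, LinearEquiv.coe_coe, WithLp.coe_linearEquiv, WithLp.coe_symm_linearEquiv]; exact hQV A t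

end LieSU

/-! ## §3 (v1.2, APPEND-ONLY; seat k0-s1-w1 g3)  The 𝔰𝔲(N)-valued edition with the `DecidableEq` instances on bonds UNIFIABLE

The kernel-formula hypotheses `hDV`∕`hGV`∕`hQV`∕`hHV` of §1–§2 write the unit fields as `Pi.single j 1`, elaborated in THIS file with the classical `DecidableEq` on `PBond (F.P K) 0`
and on `BondIdx D` (no constructive instance is imported here).  Files that also import the NODE 00 chain or k0-s1-w3's d = 4 port see the constructive instance
`B6Prop26ReachTransplant.instDecidableEqPBond`, and their `Pi.single` terms then differ from ours AS TERMS (the instances are propositionally equal: `DecidableEq _` is a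
subsingleton).  The edition below takes both instances as implicit arguments, so it unifies with either elaboration; it is §2's theorem after `Subsingleton.elim`. -/

section LieSUInst

open Literature.MathematicalPhysics.QuantumFieldTheory.Balaban1983to89.T4AdjointCovarianceUnitary (lieSU mem_lieSU_iff)

/-- ★★ `letter165_tangent_of_critical128_recordDom_lieSU` with the `DecidableEq` instances of the unit fields `Pi.single j 1` (bonds) and `Pi.single t 1` (constrained indices)
as UNIFIABLE implicit arguments (bookkeeping: `Subsingleton.elim` on the instances, then §2 verbatim). [cite: Balaban1985Variational, (158) p.302, (165) p.304] -/
theorem letter165_tangent_of_critical128_recordDom_lieSU_inst (F : T4Family) (K k : ℕ) (wt : ℕ → PBond (F.P K) 0 → ℝ)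
    (D : Domains (F.P K)) {c : ℝ} (hc : c ≠ 0) {w : BondIdx D → ℝ} (hw : ∀ i, 0 < w i)
    {instDE : DecidableEq (PBond (F.P K) 0)} {instDB : DecidableEq (BondIdx D)}
    {DV GV : (PBond (F.P K) 0 → Matrix (Fin N) (Fin N) ℂ) →ₗ[ℂ] (PBond (F.P K) 0 → Matrix (Fin N) (Fin N) ℂ)}
    {QV : (PBond (F.P K) 0 → Matrix (Fin N) (Fin N) ℂ) →ₗ[ℂ] (BondIdx D → Matrix (Fin N) (Fin N) ℂ)}
    {HV : (BondIdx D → Matrix (Fin N) (Fin N) ℂ) →ₗ[ℂ] (PBond (F.P K) 0 → Matrix (Fin N) (Fin N) ℂ)}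
    (hDV : ∀ (A : PBond (F.P K) 0 → Matrix (Fin N) (Fin N) ℂ) (b : PBond (F.P K) 0),
      DV A b = ∑ j, ((WithLp.ofLp (deltaAE D c w (WithLp.toLp 2 (Pi.single j 1))) b : ℝ) : ℂ) • A j)
    (hGV : ∀ (A : PBond (F.P K) 0 → Matrix (Fin N) (Fin N) ℂ) (b : PBond (F.P K) 0),
      GV A b = ∑ j, ((WithLp.ofLp ((GE D hc hw - hOp (GE D hc hw) (QsE D) (EE D hc hw) ∘ₗ QE D ∘ₗ GE D hc hw)
        (WithLp.toLp 2 (Pi.single j 1))) b : ℝ) : ℂ) • A j)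
    (hQV : ∀ (A : PBond (F.P K) 0 → Matrix (Fin N) (Fin N) ℂ) (t : BondIdx D),
      QV A t = ∑ j, ((WithLp.ofLp (QE D (WithLp.toLp 2 (Pi.single j 1))) t : ℝ) : ℂ) • A j)
    (hHV : ∀ (B : BondIdx D → Matrix (Fin N) (Fin N) ℂ) (b : PBond (F.P K) 0),
      HV B b = ∑ t, ((WithLp.ofLp (hOp (GE D hc hw) (QsE D) (EE D hc hw) (WithLp.toLp 2 (Pi.single t 1))) b : ℝ) : ℂ) • B t)
    (W : (PBond (F.P K) 0 → Matrix (Fin N) (Fin N) ℂ) → (PBond (F.P K) 0 → Matrix (Fin N) (Fin N) ℂ)) {C₄ a₃ ρ : ℝ}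
    (hWq : ∀ (Y : PBond (F.P K) 0 → Matrix (Fin N) (Fin N) ℂ) (r : ℝ), r < a₃ → (∀ b, wt 1 b * ‖Y b‖ ≤ r) →
      (∀ (b : PBond (F.P K) 0) (ν : Fin 4), wt 2 b * (F.L : ℝ) ^ k * ‖Y ⟨b.src.shift ν, b.dir⟩ - Y b‖ ≤ r) →
        ∀ b, wt 3 b * ‖W Y b‖ ≤ C₄ * r ^ 2)
    (X : PBond (F.P K) 0 → lieSU (Fin N))
    (hWA : ∀ j, (W (fun b => ((X b : lieSU (Fin N)) : Matrix (Fin N) (Fin N) ℂ)) j)ᴴ = -(W (fun b => ((X b : lieSU (Fin N)) : Matrix (Fin N) (Fin N) ℂ)) j))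
    (hWtr : ∀ j, (W (fun b => ((X b : lieSU (Fin N)) : Matrix (Fin N) (Fin N) ℂ)) j).trace = 0)
    (h128 : ∀ δ : PBond (F.P K) 0 → lieSU (Fin N), QV (fun j => ((δ j : lieSU (Fin N)) : Matrix (Fin N) (Fin N) ℂ)) = 0 →
      ∑ j, (((δ j : lieSU (Fin N)) : Matrix (Fin N) (Fin N) ℂ)ᴴ *
        (DV (fun b => ((X b : lieSU (Fin N)) : Matrix (Fin N) (Fin N) ℂ)) j + W (fun b => ((X b : lieSU (Fin N)) : Matrix (Fin N) (Fin N) ℂ)) j)).trace.re = 0)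
    (hρ : ρ < a₃) (h1 : ∀ b, wt 1 b * ‖((X b : lieSU (Fin N)) : Matrix (Fin N) (Fin N) ℂ)‖ ≤ ρ)
    (h2 : ∀ (b : PBond (F.P K) 0) (ν : Fin 4),
      wt 2 b * (F.L : ℝ) ^ k * ‖((X ⟨b.src.shift ν, b.dir⟩ : lieSU (Fin N)) : Matrix (Fin N) (Fin N) ℂ) - ((X b : lieSU (Fin N)) : Matrix (Fin N) (Fin N) ℂ)‖ ≤ ρ)
    (Nl : (PBond (F.P K) 0 → Matrix (Fin N) (Fin N) ℂ) → ℝ) {B : ℝ}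
    (hN : ∀ (f : PBond (F.P K) 0 → Matrix (Fin N) (Fin N) ℂ) (β : ℝ), (∀ b, wt 3 b * ‖f b‖ ≤ β) → Nl (-(GV f)) ≤ B * β) :
    Nl ((fun b => ((X b : lieSU (Fin N)) : Matrix (Fin N) (Fin N) ℂ)) - HV (QV fun b => ((X b : lieSU (Fin N)) : Matrix (Fin N) (Fin N) ℂ))) ≤ B * (C₄ * ρ ^ 2) := by
  classical
  obtain rfl : instDE = fun a b => Classical.propDecidable (a = b) := Subsingleton.elim _ _
  obtain rfl : instDB = fun a b => Subtype.instDecidableEq a b := Subsingleton.elim _ _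
  exact letter165_tangent_of_critical128_recordDom_lieSU F K k wt D hc hw hDV hGV hQV hHV W hWq X hWA hWtr h128 hρ h1 h2 Nl hN

end LieSUInst

end Summit.QuantumFields.YangMills.Theorems.K0Stub1Letter165OfCriticalFlatOps

end
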